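import Summits.QuantumFields.BalabanUV.T4Continuum.Support.ShellMeasureRootCompositionFibre
import Mathlib.MeasureTheory.Measure.Haar.Unique

/-!
# `T4Continuum.ShellMeasureWindowSection` — (LR)_j IN THE MARGINAL READING: a window centred on a SECTION of the
# block's LINEAR average is a FIXED ball on the fibre; product Lebesgue on the block DISINTEGRATES along the average;
# END-II (fibre form) applies with `dim(fibre) = dim(block) − dim(average)` coordinates
# (cell `pub-balaban`, sub-cell `t4`, spine estimate NE7c (node U5b); NE7c ROUND-2 crew `t4-ne7c-formalise-*`, seat
# leaf-10 (gen 3); continuation of this seat's OFFERED row «(LR)_j with print's fixed centre» (gen 2: p210846 /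
# p211154 / p211549) and of its LOCATOR GAPS G-ne7cL10g2-1 (R3) («in the MARGINAL reading the centre (1.26) READS the
# block's own averages — neither END applies literally»); ADDITIVE — imports `ShellMeasureRootCompositionFibre`
# (p211549) and Mathlib's Haar uniqueness only, modifies nothing; 0 `def`, 0 sorry, 0 cite)

HONEST FRAMING.  Finite four-torus programme, rung (B)+1 only — NOT infinite volume, NOT a mass gap, NOT the Clay
problem, NOT summit progress; (B), `BetaPertHyp`, (B^μ) are not consumed.  (M1) for Bałaban's inductively defined
effective measures is NOT PRINTED (GAPS G-ne7cp1-1), asserted by nobody, NOT moved here.  NE7c ⇐ the named binders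
(trigger c3); NE7c NOT PRINTED, NOT proved; spine PROVED 0/9 before and after.  STRUCTURAL BOOKKEEPING (linear
algebra + uniqueness of Haar measure) — no estimate, no `def` (c2), `[folklore]` throughout.  HONEST DEPENDENCY
(cell): continuum YM on T⁴ ⇐ BetaPertH ∧ nine spine estimates (0/9 proved); BetaPertH ⇐ (D1) ∧ (D4) ∧ CAP+tail;
G-an2-4 gates asym, D1 and NE2/3/4.

THE POINT (GAPS G-ne7cL10g2-1 (R3), this seat gen 2).  Print's window (1.27) of [Balaban1989LargeFieldI] p. 182 is
about the centre (1.26) `V_Z^{(j)} = M^j(U^{(n+1)}_{k,Z})`, a SECTION of the averaging map (the background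
`U^{(n+1)}` is built so that its averages reproduce the coarse field).  Conditionally on the coarse field the centre
is FIXED (gen 2, `ShellMeasureWindowFixedCentre`), at the price of the δ-constrained fibre law (gen 2,
`ShellMeasureRootCompositionFibre`).  In the MARGINAL reading (coarse field integrated out against
`δ(V̄_j V_{j+1}^{-1})`) the block law is an honest density w.r.t. the product law of the block variables, but the
centre `σ(Q y)` MOVES with the block's own average `Q y` — so the Λ-blind centre hypothesis `hc` of S20 fails and no
END in the tree applied literally (locator (R3), last sentence).  THIS FILE closes that case in the LINEAR MODEL OF
THE AVERAGE: the block variables form a finite-dimensional real space `E` with an additive Haar (Lebesgue) measure,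
the average is a SURJECTIVE LINEAR map `Q : E → F` (the shape of the LINEAR block-averaging operator on vector
fields that the tree types as `Setup.LinAveraging` — B5 (1.6)–(1.8)/(1.11) — and of the fluctuation-field constraint
in the quadratic form of (1.25); a READING of which variables carry the product law, no locus asserted; for
group-valued `V_j` the average is nonlinear and the fibre curved — DISPLAYED, the [dict] push),
and the centre is `σ (Q y)` for ANY measurable section `σ` of `Q` (`Q ∘ σ = id`; nonlinear allowed — print's
`M^j ∘ (minimiser)` is nonlinear).  Then:
* §1 `exists_splitting`: a linear chart `Φ : ker Q × F ≃L E` adapted to the average (`Q (Φ (x, b)) = b`,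
  `Φ (x, 0) = x`); `finrank_fibre_add`: `dim ker Q + dim F = dim E`.
* §2 DISINTEGRATION: `map_prod_eq_smul` — ANY linear splitting pushes (Haar on the fibre model) ⊗ (Haar on `F`) to
  `c • Haar_E`, `0 < c < ∞` (uniqueness of Haar measure); `measurePreserving_shear` — the shear
  `(x, b) ↦ (τ b + x, b)` by a measurable `τ` preserves the product law; `measurePreserving_sectionChart` — hence
  the NONLINEAR section chart `(x, b) ↦ σ b + Φ (x, 0)` pushes the product law to `c • Haar_E` as well;
  `slotAC_of_sectionChart` — (M1) for `Haar_E.withDensity G` ⇐ (M1) for the product law tilted by `G ∘ chart`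
  (same `θ, ρ, D`: the constant `c` cancels in (M1)).
* §3 THE WINDOW: `average_sectionChart` (the charted point `σ b + Φ (x, 0)` has average `b`),
  `window_sectionChart` — print's window `1{‖y − σ(Q y)‖ < r}` READ THROUGH THE CHART is the FIXED ball
  `1{‖Φ (x, 0)‖ < r}` in the fibre coordinate, for EVERY section `σ`; `centreMonotone_comp`,
  `ballIndicator_starMonotone` — it is a centre-monotone co-test (`Jco`) in `x`, NO smallness, NO `hc`.
* §4 THE END `slotAC_sectionWindow_of_levelData` (+ `_of_surjective`, the `ker Q` form): (M1) for the realized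
  slot law `((Haar_E.prod ζ).withDensity G)` — product Lebesgue on the block's variables × ANY s-finite exterior law,
  density `G` (window about `σ_z(Q y)` × weights inside `G`) — from E2′'s LEVEL DATA IN THE FIBRE COORDINATE
  `x ∈ ker Q`, indexed by the exterior point `z` AND the average value `b`; constant LITERALLY E2′'s with
  `n ↦ finrank ℝ (ker Q)` (= `dim E − dim F`): `2(finrank(ker Q) + β Σ_p L̄_p(d̄_p + 4s̄_p) + B_𝓔)/(1−δ)`.  Proof =
  `T4ShellMeasureLocal.slotAntiConcentration_of_sections` ∘ §2 ∘ `ShellMeasureRootCompositionFibre.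
  slotAC_fibre_of_levelData` (exterior of the fibre END := the average value `b`).
CONSEQUENCE FOR THE LEDGER (c3-honest).  In the linear model of the average, BOTH readings of (1.25) land on the
fibre END with the same level data: conditional (gen 2: `b` frozen in the exterior) and marginal (this file: `b`
integrated, Lebesgue on `E` disintegrated along `Q`).  The residual READING of (LR)_j is therefore NOT the centre
(any section of the average is admissible, moving or not) but only the LINEARITY OF THE AVERAGE in the variables
carrying the product law — i.e. the fibre chart of the nonlinear group-valued average (B12 §1 / B13), DISPLAYED as
before.  Nothing printed is asserted; no instance of SM-L1/L3/L4/L6 at any `j ≥ 1`; (M1) per slot stays THE wall.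
-/

noncomputable section

open Set Function MeasureTheory MeasureTheory.Measure Metric

namespace Summit.QuantumFields.BalabanUV.T4Continuum.ShellMeasureWindowSection

open scoped ENNReal NNReal
open Literature.MathematicalPhysics.QuantumFieldTheory.Balaban1983to89
open T4ShellMeasure (SlotAntiConcentration)
open T4ShellMeasureLocal (slotAntiConcentration_of_sections)
open T4ShellMeasureDet (slotAntiConcentration_withDensity_map)
open ShellMeasureWilsonTrace (TraceData)
open ShellMeasureWilsonMoving (MLetter mwordEval mdFro sSum lSum)
open ShellMeasureLevelAssembly (classifier weight)
open ShellMeasureRootCompositionFibre (slotAC_fibre_of_levelData)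

variable {E F : Type*} [NormedAddCommGroup E] [NormedSpace ℝ E] [NormedAddCommGroup F] [NormedSpace ℝ F]

/-! ## §1 A linear chart of the block space adapted to a surjective linear average -/

section Splitting

variable [FiniteDimensional ℝ E] [FiniteDimensional ℝ F]

/-- **LINEAR SPLITTING ALONG THE AVERAGE.**  For a surjective linear map `Q : E → F` between finite-dimensional
real normed spaces (the block's LINEAR average) there is a continuous linear chart `Φ : ker Q × F ≃ E` with
`Q (Φ (x, b)) = b` (the second coordinate IS the average) and `Φ (x, 0) = x` (the first coordinate is the fibre
`ker Q` itself): `Φ (x, b) = x + s b` for a linear right inverse `s` of `Q`. [folklore] -/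
theorem exists_splitting (Q : E →ₗ[ℝ] F) (hQ : Function.Surjective Q) :
    ∃ Φ : (LinearMap.ker Q × F) ≃L[ℝ] E, (∀ p, Q (Φ p) = p.2) ∧ ∀ x : LinearMap.ker Q, Φ (x, 0) = x := by
  obtain ⟨s, hs⟩ := Q.exists_rightInverse_of_surjective (LinearMap.range_eq_top.2 hQ)
  have hsQ : ∀ b, Q (s b) = b := fun b => by
    have := LinearMap.congr_fun hs b
    simpa using this
  have hker : ∀ y : E, ((LinearMap.id : E →ₗ[ℝ] E) - s ∘ₗ Q) y ∈ LinearMap.ker Q := fun y => by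
    simp [LinearMap.mem_ker, hsQ]
  let Φl : (LinearMap.ker Q × F) →ₗ[ℝ] E := (LinearMap.ker Q).subtype.coprod s
  let Ψl : E →ₗ[ℝ] (LinearMap.ker Q × F) :=
    LinearMap.prod (LinearMap.codRestrict (LinearMap.ker Q) ((LinearMap.id : E →ₗ[ℝ] E) - s ∘ₗ Q) hker) Q
  have hΦl : ∀ x b, Φl (x, b) = (x : E) + s b := fun x b => by
    simp [Φl]
  have h1 : ∀ p, Ψl (Φl p) = p := by
    rintro ⟨x, b⟩
    have hx : Q (x : E) = 0 := x.2
    refine Prod.ext (Subtype.ext ?_) ?_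
    · simp [Ψl, hΦl, hx, hsQ]
    · simp [Ψl, hΦl, hx, hsQ]
  have h2 : ∀ y, Φl (Ψl y) = y := fun y => by
    simp [Ψl, hΦl]
  let Φe : (LinearMap.ker Q × F) ≃ₗ[ℝ] E :=
    { Φl with invFun := Ψl, left_inv := h1, right_inv := h2 }
  refine ⟨Φe.toContinuousLinearEquiv, fun p => ?_, fun x => ?_⟩
  · rcases p with ⟨x, b⟩
    have hx : Q (x : E) = 0 := x.2
    show Q (Φl (x, b)) = b
    rw [hΦl, map_add, hx, hsQ, zero_add]
  · show Φl (x, 0) = x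
    rw [hΦl, map_zero, add_zero]

end Splitting

/-! ## §2 Disintegration of the block's Lebesgue measure along the average; the section chart -/

section Disintegration

variable [MeasurableSpace E] [BorelSpace E] [FiniteDimensional ℝ E] [MeasurableSpace F] [BorelSpace F]
  [FiniteDimensional ℝ F] {Kf : Type*} [NormedAddCommGroup Kf] [NormedSpace ℝ Kf] [MeasurableSpace Kf]
  [BorelSpace Kf] [FiniteDimensional ℝ Kf] (μK : Measure Kf) [μK.IsAddHaarMeasure] (μF : Measure F)
  [μF.IsAddHaarMeasure] (μE : Measure E) [μE.IsAddHaarMeasure]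

omit [MeasurableSpace E] [BorelSpace E] [FiniteDimensional ℝ E] [MeasurableSpace F] [BorelSpace F]
  [MeasurableSpace Kf] [BorelSpace Kf] in
/-- dimension count of the fibre: `dim(fibre model) + dim(average) = dim(block)` for any linear splitting; with
`exists_splitting`, `finrank ℝ (ker Q) + finrank ℝ F = finrank ℝ E`. [folklore] -/
theorem finrank_fibre_add (Φ : (Kf × F) ≃L[ℝ] E) :
    Module.finrank ℝ Kf + Module.finrank ℝ F = Module.finrank ℝ E := by
  rw [← Module.finrank_prod, LinearEquiv.finrank_eq Φ.toLinearEquiv]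


/-- **ANY LINEAR SPLITTING DISINTEGRATES LEBESGUE MEASURE**: a continuous linear chart `Φ : Kf × F ≃ E` pushes
(additive Haar on the fibre model) ⊗ (additive Haar on the average space) to `c • (additive Haar on E)` with
`0 < c < ∞` — uniqueness of Haar measure on `E`; `c = |det Φ|` in matching Lebesgue normalisations, not needed.
[folklore] -/
theorem map_prod_eq_smul (Φ : (Kf × F) ≃L[ℝ] E) :
    ∃ c : ℝ≥0∞, c ≠ 0 ∧ c ≠ ∞ ∧ (μK.prod μF).map Φ = c • μE := by
  have : IsAddHaarMeasure ((μK.prod μF).map Φ) := Φ.isAddHaarMeasure_map _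
  refine ⟨addHaarScalarFactor ((μK.prod μF).map Φ) μE, ?_, ENNReal.coe_ne_top,
    isAddLeftInvariant_eq_smul _ _⟩
  simpa only [ne_eq, ENNReal.coe_eq_zero] using
    (addHaarScalarFactor_pos_of_isAddHaarMeasure ((μK.prod μF).map Φ) μE).ne'

omit [NormedAddCommGroup F] [NormedSpace ℝ F] [BorelSpace F] [FiniteDimensional ℝ F] in
/-- **THE SHEAR PRESERVES THE PRODUCT LAW**: `(x, b) ↦ (τ b + x, b)` for a measurable `τ : F → Kf` preserves
(additive Haar on `Kf`) ⊗ (any s-finite law on `F`) — translation invariance fibre by fibre (Mathlib's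
`MeasurePreserving.skew_product`, conjugated by the swap). [folklore] -/
theorem measurePreserving_shear (ν : Measure F) [SFinite ν] {τ : F → Kf} (hτ : Measurable τ) :
    MeasurePreserving (fun p : Kf × F => (τ p.2 + p.1, p.2)) (μK.prod ν) (μK.prod ν) := by
  have hS : MeasurePreserving (fun q : F × Kf => (q.1, τ q.1 + q.2)) (ν.prod μK) (ν.prod μK) :=
    (MeasurePreserving.id ν).skew_product (g := fun b x => τ b + x)
      ((hτ.comp measurable_fst).add measurable_snd)
      (Filter.Eventually.of_forall fun b => map_add_left_eq_self μK (τ b))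
  exact ((measurePreserving_swap (μ := ν) (ν := μK)).comp hS).comp
    (measurePreserving_swap (μ := μK) (ν := ν))

/-- **THE SECTION CHART IS MEASURE PRESERVING ONTO `c • Haar_E`.**  For a linear splitting `Φ` and ANY measurable
`σ : F → E` that is a SECTION of the average in the chart (`(Φ.symm (σ b)).2 = b`, i.e. `Q (σ b) = b` for the
splitting of `exists_splitting`), the nonlinear chart `(x, b) ↦ σ b + Φ (x, 0)` («centre at the section value of
the average, plus a fibre fluctuation») pushes the product law to the SAME `c • Haar_E` as `Φ`: it is `Φ` composed
with the shear by `τ b = (Φ.symm (σ b)).1`. [folklore] -/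
theorem measurePreserving_sectionChart (Φ : (Kf × F) ≃L[ℝ] E) {σ : F → E} (hσm : Measurable σ)
    (hσ : ∀ b, (Φ.symm (σ b)).2 = b) :
    ∃ c : ℝ≥0∞, c ≠ 0 ∧ c ≠ ∞ ∧
      MeasurePreserving (fun p : Kf × F => σ p.2 + Φ (p.1, 0)) (μK.prod μF) (c • μE) := by
  obtain ⟨c, hc0, hc1, hmap⟩ := map_prod_eq_smul μK μF μE Φ
  refine ⟨c, hc0, hc1, ?_⟩
  have hτ : Measurable fun b => (Φ.symm (σ b)).1 :=
    measurable_fst.comp (Φ.symm.continuous.measurable.comp hσm)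
  have hT := measurePreserving_shear μK μF hτ
  have hΦ : MeasurePreserving (Φ : Kf × F → E) (μK.prod μF) (c • μE) := ⟨Φ.continuous.measurable, hmap⟩
  have heq : (Φ : Kf × F → E) ∘ (fun p : Kf × F => ((Φ.symm (σ p.2)).1 + p.1, p.2)) =
      fun p => σ p.2 + Φ (p.1, 0) := by
    funext p
    have hp : ((Φ.symm (σ p.2)).1, p.2) = Φ.symm (σ p.2) := Prod.ext rfl (hσ p.2).symm
    have hsum : (((Φ.symm (σ p.2)).1 + p.1, p.2) : Kf × F) = ((Φ.symm (σ p.2)).1, p.2) + (p.1, 0) := by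
      ext <;> simp
    simp only [comp_apply]
    rw [hsum, map_add, hp, ContinuousLinearEquiv.apply_symm_apply]
  rw [← heq]
  exact hΦ.comp hT

/-- **(M1) THROUGH THE SECTION CHART.**  (M1) for the block's Lebesgue law tilted by a measurable density `G`, with
measurable tested variable `u`, FOLLOWS from (M1) for the product law (fibre model ⊗ average space) tilted by
`G ∘ chart` with variable `u ∘ chart`, SAME `θ, ρ, D` — the disintegration constant `c` cancels in (M1). [folklore] -/
theorem slotAC_of_sectionChart (Φ : (Kf × F) ≃L[ℝ] E) {σ : F → E} (hσm : Measurable σ)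
    (hσ : ∀ b, (Φ.symm (σ b)).2 = b) {G : E → ℝ≥0∞} (hG : Measurable G) {u : E → ℝ} (hu : Measurable u)
    {θ ρ D : ℝ}
    (h : SlotAntiConcentration ((μK.prod μF).withDensity fun p => G (σ p.2 + Φ (p.1, 0)))
      (fun p => u (σ p.2 + Φ (p.1, 0))) θ ρ D) :
    SlotAntiConcentration (μE.withDensity G) u θ ρ D := by
  obtain ⟨c, hc0, hc1, he⟩ := measurePreserving_sectionChart μK μF μE Φ hσm hσ
  have h1 : SlotAntiConcentration ((c • μE).withDensity G) u θ ρ D :=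
    slotAntiConcentration_withDensity_map he hG hu h
  rw [withDensity_smul_measure] at h1
  -- the constant `c` cancels in (M1)
  unfold SlotAntiConcentration at h1 ⊢
  rw [Measure.smul_apply, Measure.smul_apply, smul_eq_mul, smul_eq_mul, mul_left_comm] at h1
  exact (ENNReal.mul_le_mul_iff_right hc0 hc1).1 h1

end Disintegration

/-! ## §3 The window about a section of the average, read in the fibre coordinate -/

section Window

variable {Kf : Type*} [NormedAddCommGroup Kf] [NormedSpace ℝ Kf]

/-- the fluctuation of the charted point about its centre IS the fibre coordinate. [folklore] -/
theorem sectionChart_sub_centre (Φ : (Kf × F) ≃L[ℝ] E) (σ : F → E) (x : Kf) (b : F) :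
    σ b + Φ (x, 0) - σ b = Φ (x, 0) :=
  add_sub_cancel_left _ _

/-- the charted point `σ b + Φ (x, 0)` HAS AVERAGE `b` (for a section `σ` of the average): the centre read off the
block's own average is `σ b` — it does not see the fibre fluctuation. [folklore] -/
theorem average_sectionChart (Φ : (Kf × F) ≃L[ℝ] E) {σ : F → E} (hσ : ∀ b, (Φ.symm (σ b)).2 = b) (x : Kf)
    (b : F) : (Φ.symm (σ b + Φ (x, 0))).2 = b := by
  rw [map_add, ContinuousLinearEquiv.symm_apply_apply, Prod.snd_add, hσ]
  simp

/-- **PRINT'S WINDOW IS A FIXED BALL ON THE FIBRE.**  The window «distance of the block variable from the centre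
READ OFF ITS OWN AVERAGE is `< r`», `1{‖y − σ((Φ.symm y).2)‖ < r}` (the linear-model shape of (1.27) with centre
(1.26) in the marginal reading), evaluated at the charted point `σ b + Φ (x, 0)`, equals the ball co-test
`1{‖Φ (x, 0)‖ < r}` in the fibre coordinate — for EVERY section `σ`, moving or not; no `hc`, no smallness. [folklore] -/
theorem window_sectionChart (Φ : (Kf × F) ≃L[ℝ] E) {σ : F → E} (hσ : ∀ b, (Φ.symm (σ b)).2 = b) (r : ℝ)
    (x : Kf) (b : F) :
    {y : E | ‖y - σ (Φ.symm y).2‖ < r}.indicator (1 : E → ℝ≥0∞) (σ b + Φ (x, 0)) =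
      {v : E | ‖v‖ < r}.indicator 1 (Φ (x, 0)) := by
  by_cases hx : ‖Φ (x, 0)‖ < r
  · have hmem : σ b + Φ (x, 0) ∈ {y : E | ‖y - σ (Φ.symm y).2‖ < r} := by
      rw [mem_setOf_eq, average_sectionChart Φ hσ, add_sub_cancel_left]; exact hx
    rw [indicator_of_mem hmem, indicator_of_mem (show Φ (x, 0) ∈ {v : E | ‖v‖ < r} from hx)]
    rfl
  · have hnmem : σ b + Φ (x, 0) ∉ {y : E | ‖y - σ (Φ.symm y).2‖ < r} := by
      rw [mem_setOf_eq, average_sectionChart Φ hσ, add_sub_cancel_left]; exact hx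
    rw [indicator_of_notMem hnmem, indicator_of_notMem (show Φ (x, 0) ∉ {v : E | ‖v‖ < r} from hx)]

/-- a co-test on the block that is STAR-MONOTONE about `0` (`w v ≤ w (e^{−a} v)`, `a ≥ 0`), read in the fibre
coordinate through the linear chart, is CENTRE-MONOTONE in `x` — the shape of E2′'s binder `hJ`. [folklore] -/
theorem centreMonotone_comp (Φ : (Kf × F) ≃L[ℝ] E) {w : E → ℝ≥0∞}
    (hw : ∀ v : E, ∀ a : ℝ, 0 ≤ a → w v ≤ w (Real.exp (-a) • v)) (x : Kf) (a : ℝ) (ha : 0 ≤ a) :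
    w (Φ (x, 0)) ≤ w (Φ (Real.exp (-a) • x, 0)) := by
  have h : Φ (Real.exp (-a) • x, 0) = Real.exp (-a) • Φ (x, 0) := by
    rw [← map_smul, Prod.smul_mk, smul_zero]
  rw [h]
  exact hw _ a ha

/-- the norm-ball indicator `1{‖v‖ < r}` is star-monotone about `0` (`‖e^{−a} v‖ ≤ ‖v‖`). [folklore] -/
theorem ballIndicator_starMonotone (r : ℝ) (v : E) (a : ℝ) (ha : 0 ≤ a) :
    {v : E | ‖v‖ < r}.indicator (1 : E → ℝ≥0∞) v ≤ {v : E | ‖v‖ < r}.indicator 1 (Real.exp (-a) • v) := by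
  by_cases hv : ‖v‖ < r
  · have hle : ‖Real.exp (-a) • v‖ ≤ ‖v‖ := by
      rw [norm_smul, Real.norm_eq_abs, abs_of_pos (Real.exp_pos _)]
      exact mul_le_of_le_one_left (norm_nonneg _) (Real.exp_le_one_iff.2 (neg_nonpos.2 ha))
    rw [indicator_of_mem (show v ∈ {v : E | ‖v‖ < r} from hv),
      indicator_of_mem (show Real.exp (-a) • v ∈ {v : E | ‖v‖ < r} from lt_of_le_of_lt hle hv)]
    exact le_rfl
  · rw [indicator_of_notMem (show v ∉ {v : E | ‖v‖ < r} from hv)]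
    exact bot_le

end Window

/-! ## §4 THE END: (M1) for product Lebesgue on the block, windowed about a section of the linear average -/

section End

variable [MeasurableSpace E] [BorelSpace E] [FiniteDimensional ℝ E] [MeasurableSpace F] [BorelSpace F]
  [FiniteDimensional ℝ F] {Kf : Type*} [NormedAddCommGroup Kf] [NormedSpace ℝ Kf] [MeasurableSpace Kf]
  [BorelSpace Kf] [FiniteDimensional ℝ Kf] (μK : Measure Kf) [μK.IsAddHaarMeasure] (μE : Measure E)
  [μE.IsAddHaarMeasure]
variable {A : Type*} [NormedRing A] [NormedAlgebra ℂ A] [CompleteSpace A] [NormOneClass A]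

/-- **END-II, MARGINAL READING, LINEAR AVERAGE — REALIZED (M1) ⇐ SM-L1…L6 + DICTIONARY IN THE FIBRE COORDINATE,
PER SLOT, ANY LEVEL.**  Data: the block space `E` with additive Haar (Lebesgue) measure `μE`; the average space `F`
(`μF`) and a fibre model `Kf` (`μK`) with a linear splitting `Φ : Kf × F ≃ E` (from `exists_splitting` for a
surjective linear average `Q`, `Kf = ker Q`); ANY exterior space `Z` with an s-finite law `ζ`; the realized slot law
`((μE.prod ζ).withDensity G)` — PRODUCT LEBESGUE ON THE BLOCK VARIABLES with a measurable density `G` (window about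
the moving centre × weights, inside `G`) — and a measurable tested variable `u`; for every exterior point `z` a
measurable SECTION `σ z` of the average (`(Φ.symm (σ z b)).2 = b`: the centre read off the average value `b`);
finiteness of the tilted FIBRE laws `hfin`.  LEVEL DATA per `(z, b)` IN THE FIBRE COORDINATE `x : Kf` (E2′'s):
`hol`, `Gw`, `𝓔`, `W`, `Jco`, sizes, numbers; DICTIONARY `hFdict` (`G` at the charted point `σ z b + Φ (x, 0)` IS
`Jco · weight`), `hudict` (`u` there IS the classifier, on the support); BINDERS `hJW`/`hJ` (SM-L5/L6 — e.g. the
print-shaped window, a fixed ball in `x` by `window_sectionChart`, centre-monotone by `centreMonotone_comp`), `hAN`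
(SM-L1), `hGW` (SM-L3), `hE` (SM-L4), `hSM` (SM-L2).  CONCLUSION: `SlotAntiConcentration ((μE.prod ζ).withDensity G)
u θ ρ (2(finrank ℝ Kf + β Σ_p L̄_p(d̄_p + 4s̄_p) + B_𝓔)/(1−δ))` — E2′'s constant with `n ↦ dim Kf = dim E − dim F`
(`finrank_fibre_add`).  Proof: sections over `z` ∘ `slotAC_of_sectionChart` ∘ the fibre END with exterior := the
average value `b`.  CONDITIONAL on every binder; the linearity of the average is the MODEL; nothing PRINTED is
asserted. [folklore] -/
theorem slotAC_sectionWindow_of_levelData (Φ : (Kf × F) ≃L[ℝ] E) {Z : Type*} [MeasurableSpace Z]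
    (ζ : Measure Z) [SFinite ζ] {G : E × Z → ℝ≥0∞} (hG : Measurable G) {u : E × Z → ℝ} (hu : Measurable u)
    {σ : Z → F → E} (hσm : ∀ z, Measurable (σ z)) (hσ : ∀ z b, (Φ.symm (σ z b)).2 = b)
    (hfin : ∀ z b, (μK.withDensity fun x => G (σ z b + Φ (x, 0), z)) univ ≠ ∞)
    -- level data per exterior point AND average value, in the fibre coordinate
    (Ttr : TraceData A) (hN : 0 < Ttr.N) {ι κ : Type*} {Pu : Finset ι} (hPu : Pu.Nonempty)
    (hol : Z → F → ι → Kf → A) (hcont : ∀ z b, ∀ p ∈ Pu, Continuous (hol z b p))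
    (Pw : Finset κ) (Gw : Z → F → κ → Kf → A) (𝓔 : Z → F → Kf → ℝ) (W : Z → F → Set Kf)
    (Jco : Z → F → Kf → ℝ≥0∞) {θ δ ρ β Rad H B𝓔 : ℝ} {sw lw dw : κ → ℝ}
    -- DICTIONARY at the charted point
    (hFdict : ∀ z b x, G (σ z b + Φ (x, 0), z) = Jco z b x * weight Ttr β Pw (Gw z b) (𝓔 z b) x)
    (hudict : ∀ z b x, G (σ z b + Φ (x, 0), z) ≠ 0 → u (σ z b + Φ (x, 0), z) = classifier hPu (hol z b) x)
    -- SM-L5/L6: kept co-tests supported in the window, centre-monotone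
    (hJW : ∀ z b x, Jco z b x ≠ 0 → x ∈ W z b)
    (hJ : ∀ z b x, ∀ a : ℝ, 0 ≤ a → Jco z b x ≤ Jco z b (Real.exp (-a) • x))
    -- SM-L1 (AN-bound)
    (hRad : 1 < Rad)
    (hAN : ∀ z b, ∀ x ∈ W z b, ∀ p ∈ Pu, ∃ f : ℂ → A, DifferentiableOn ℂ f (ball 0 Rad) ∧
      (∀ w ∈ ball (0 : ℂ) Rad, ‖f w‖ ≤ H) ∧ f 0 = 0 ∧
      ∀ c' : ℝ, 0 ≤ c' → c' ≤ 1 → f (c' : ℂ) = hol z b p (c' • x) - 1)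
    -- SM-L3 graded sectioned words
    (hGW : ∀ z b, ∀ x ∈ W z b, ∀ p ∈ Pw, ∃ gw : List (MLetter A × ℝ × ℝ), (∀ y ∈ gw, y.1.Good Ttr.τ y.2.1 y.2.2) ∧
      sSum gw ≤ sw p ∧ lSum gw ≤ lw p ∧ mdFro (gw.map Prod.fst) ≤ dw p ∧
      ∀ c' : ℝ, 0 ≤ c' → c' ≤ 1 → mwordEval c' (gw.map Prod.fst) = Gw z b p (c' • x))
    (hsw1 : ∀ p ∈ Pw, sw p ≤ 1) (hsw0 : ∀ p ∈ Pw, 0 ≤ sw p) (hlw0 : ∀ p ∈ Pw, 0 ≤ lw p)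
    (hdw0 : ∀ p ∈ Pw, 0 ≤ dw p)
    -- SM-L4 non-Wilson ray bound
    (hE : ∀ z b, ∀ x ∈ W z b, ∀ c' : ℝ, 1 / 2 ≤ c' → c' ≤ 1 → 𝓔 z b (c' • x) ≤ 𝓔 z b x + (1 - c') * B𝓔)
    (hB𝓔 : 0 ≤ B𝓔)
    -- numbers + SM-L2 (SM)
    (hθ : 0 < θ) (hδ0 : 0 ≤ δ) (hδ1 : δ < 1) (hρ0 : 0 ≤ ρ) (hρ : ρ ≤ (1 - δ) / 2) (hβ : 0 ≤ β)
    (hSM : 36 * H * 1 ^ 2 / (Rad - 1) ^ 2 ≤ δ * θ) :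
    SlotAntiConcentration ((μE.prod ζ).withDensity G) u θ ρ
      (2 * ((Module.finrank ℝ Kf : ℝ) + (β * ∑ p ∈ Pw, lw p * (dw p + 4 * sw p) + B𝓔)) / (1 - δ)) := by
  refine slotAntiConcentration_of_sections μE ζ hG hu fun z => ?_
  -- the chart of exterior point `z`
  have hch : Measurable fun p : Kf × F => σ z p.2 + Φ (p.1, 0) :=
    ((hσm z).comp measurable_snd).add (Φ.continuous.measurable.comp (measurable_fst.prodMk measurable_const))
  have hGz : Measurable fun y : E => G (y, z) := hG.comp measurable_prodMk_right
  have huz : Measurable fun y : E => u (y, z) := hu.comp measurable_prodMk_right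
  refine slotAC_of_sectionChart μK (addHaar : Measure F) μE Φ (hσm z) (hσ z) hGz huz ?_
  -- (M1) for the product law tilted by `G ∘ chart`: the fibre END with exterior := the average value
  exact slotAC_fibre_of_levelData μK (addHaar : Measure F) (F := fun p : Kf × F => G (σ z p.2 + Φ (p.1, 0), z))
    (hGz.comp hch) (hfin z) (u := fun p : Kf × F => u (σ z p.2 + Φ (p.1, 0), z)) (huz.comp hch) Ttr hN hPu
    (hol z) (hcont z) Pw (Gw z) (𝓔 z) (W z) (Jco z) (hFdict z) (hudict z) (hJW z) (hJ z) hRad (hAN z) (hGW z)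
    hsw1 hsw0 hlw0 hdw0 (hE z) hB𝓔 hθ hδ0 hδ1 hρ0 hρ hβ hSM

/-- **THE `ker Q` FORM.**  The same END stated directly for a SURJECTIVE LINEAR AVERAGE `Q : E → F`: fibre model
`ker Q` with any additive Haar measure `μK` on it, sections `Q (σ z b) = b`, charted point `σ z b + x`
(`x : ker Q`), constant `2(finrank ℝ (ker Q) + …)/(1−δ)`; the splitting is supplied by `exists_splitting` inside the
proof and does not appear in the statement.  CONDITIONAL; the linearity of `Q` is the MODEL. [folklore] -/
theorem slotAC_sectionWindow_of_surjective (Q : E →ₗ[ℝ] F) (hQ : Function.Surjective Q)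
    (μK : Measure (LinearMap.ker Q)) [μK.IsAddHaarMeasure] {Z : Type*} [MeasurableSpace Z]
    (ζ : Measure Z) [SFinite ζ] {G : E × Z → ℝ≥0∞} (hG : Measurable G) {u : E × Z → ℝ} (hu : Measurable u)
    {σ : Z → F → E} (hσm : ∀ z, Measurable (σ z)) (hσ : ∀ z b, Q (σ z b) = b)
    (hfin : ∀ z b, (μK.withDensity fun x : LinearMap.ker Q => G (σ z b + x, z)) univ ≠ ∞)
    (Ttr : TraceData A) (hN : 0 < Ttr.N) {ι κ : Type*} {Pu : Finset ι} (hPu : Pu.Nonempty)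
    (hol : Z → F → ι → LinearMap.ker Q → A) (hcont : ∀ z b, ∀ p ∈ Pu, Continuous (hol z b p))
    (Pw : Finset κ) (Gw : Z → F → κ → LinearMap.ker Q → A) (𝓔 : Z → F → LinearMap.ker Q → ℝ)
    (W : Z → F → Set (LinearMap.ker Q)) (Jco : Z → F → LinearMap.ker Q → ℝ≥0∞)
    {θ δ ρ β Rad H B𝓔 : ℝ} {sw lw dw : κ → ℝ}
    (hFdict : ∀ z b (x : LinearMap.ker Q),
      G (σ z b + x, z) = Jco z b x * weight Ttr β Pw (Gw z b) (𝓔 z b) x)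
    (hudict : ∀ z b (x : LinearMap.ker Q),
      G (σ z b + x, z) ≠ 0 → u (σ z b + x, z) = classifier hPu (hol z b) x)
    (hJW : ∀ z b x, Jco z b x ≠ 0 → x ∈ W z b)
    (hJ : ∀ z b x, ∀ a : ℝ, 0 ≤ a → Jco z b x ≤ Jco z b (Real.exp (-a) • x))
    (hRad : 1 < Rad)
    (hAN : ∀ z b, ∀ x ∈ W z b, ∀ p ∈ Pu, ∃ f : ℂ → A, DifferentiableOn ℂ f (ball 0 Rad) ∧
      (∀ w ∈ ball (0 : ℂ) Rad, ‖f w‖ ≤ H) ∧ f 0 = 0 ∧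
      ∀ c' : ℝ, 0 ≤ c' → c' ≤ 1 → f (c' : ℂ) = hol z b p (c' • x) - 1)
    (hGW : ∀ z b, ∀ x ∈ W z b, ∀ p ∈ Pw, ∃ gw : List (MLetter A × ℝ × ℝ), (∀ y ∈ gw, y.1.Good Ttr.τ y.2.1 y.2.2) ∧
      sSum gw ≤ sw p ∧ lSum gw ≤ lw p ∧ mdFro (gw.map Prod.fst) ≤ dw p ∧
      ∀ c' : ℝ, 0 ≤ c' → c' ≤ 1 → mwordEval c' (gw.map Prod.fst) = Gw z b p (c' • x))
    (hsw1 : ∀ p ∈ Pw, sw p ≤ 1) (hsw0 : ∀ p ∈ Pw, 0 ≤ sw p) (hlw0 : ∀ p ∈ Pw, 0 ≤ lw p)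
    (hdw0 : ∀ p ∈ Pw, 0 ≤ dw p)
    (hE : ∀ z b, ∀ x ∈ W z b, ∀ c' : ℝ, 1 / 2 ≤ c' → c' ≤ 1 → 𝓔 z b (c' • x) ≤ 𝓔 z b x + (1 - c') * B𝓔)
    (hB𝓔 : 0 ≤ B𝓔)
    (hθ : 0 < θ) (hδ0 : 0 ≤ δ) (hδ1 : δ < 1) (hρ0 : 0 ≤ ρ) (hρ : ρ ≤ (1 - δ) / 2) (hβ : 0 ≤ β)
    (hSM : 36 * H * 1 ^ 2 / (Rad - 1) ^ 2 ≤ δ * θ) :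
    SlotAntiConcentration ((μE.prod ζ).withDensity G) u θ ρ
      (2 * ((Module.finrank ℝ (LinearMap.ker Q) : ℝ) + (β * ∑ p ∈ Pw, lw p * (dw p + 4 * sw p) + B𝓔)) /
        (1 - δ)) := by
  obtain ⟨Φ, hΦQ, hΦ0⟩ := exists_splitting Q hQ
  have hσ' : ∀ z b, (Φ.symm (σ z b)).2 = b := fun z b => by
    have h := hΦQ (Φ.symm (σ z b))
    rw [ContinuousLinearEquiv.apply_symm_apply, hσ] at h
    exact h.symm
  refine slotAC_sectionWindow_of_levelData μK μE Φ ζ hG hu hσm hσ' (fun z b => ?_) Ttr hN hPu hol hcont Pw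
    Gw 𝓔 W Jco (fun z b x => ?_) (fun z b x => ?_) hJW hJ hRad hAN hGW hsw1 hsw0 hlw0 hdw0 hE hB𝓔 hθ hδ0 hδ1
    hρ0 hρ hβ hSM
  · simpa only [hΦ0] using hfin z b
  · rw [hΦ0]; exact hFdict z b x
  · rw [hΦ0]; exact hudict z b x

end End

end Summit.QuantumFields.BalabanUV.T4Continuum.ShellMeasureWindowSection

end
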